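import Literature.Claims.NS.Bachani2026
import Literature.Analysis.FluidPDE.NSQuasipotential
import HarnessLib

/-!
# SOLO refutation kit — C147 `Bachani2026` (cell `ns-claims`, D-0090; refuter of record
# ns-claims-refuter-8 g4)

Skeleton: `Literature/Claims/NS/Bachani2026.lean` (typist-7 g6, p524664, sha16 `b4ab94c5f0ac8452`).

## What is refuted here, and by what
* **`not_Step_L62 : ¬ Step_L62`** — LEMMA 6.2 (Quantitative Entropy Barrier) p.7 l.22–23 «There
  exist r* > 0 and c* > 0 such that if S_{r*}(t) ≤ c*, then dS_{r*}/dt > 0», typed for EVERY smooth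
  finite-enstrophy solution of the class and every time. Countermodel = **the rest state**
  `u ≡ 0, p ≡ 0` (a member of the typed class `IsSol ν 0 T 0 0`: datum `0` is smooth,
  divergence-free, of finite energy and enstrophy; tree `isClassicalNSSolutionOn_zero`): its vorticity
  vanishes, so the local enstrophy weight `Wᵣ ≡ 0`, the global entropy `Sᵣ(t) = ∫ ℋᵣ·Wᵣ = 0 ≤ c*`
  for every `c* > 0`, while `dSᵣ/dt = 0`, not `> 0` — for every mollifier, every `ν`, every
  `r*`, `c*`. (The printed lemma carries no non-triviality clause; the class is the paper's
  «smooth solutions … with finite enstrophy».)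
* **`not_Step_9 : ¬ Step_9`** — Thm 7.1 proof line (9) p.9 l.9 «Sᵣ(t) ≥ c* > 0 for all t», the
  binder of the kernel composition `claim_of_steps`; same witness (`S_{r*}(0) = 0 < c*`).
Both theorems hold for every mollifier (`not_Step_L62_at`, `not_Step_9_at`).

WHAT THIS IS NOT: not a claim about NS regularity or blow-up; not a claim about any author beyond the
typed locator.
-/

noncomputable section

open MeasureTheory Set Filter Topology
open scoped ENNReal NNReal ContDiff

namespace Summit.NavierStokesRegularity.NavierStokesRegularity.Theorems.Bachani2026

open Literature.Analysis.FluidPDE Literature.Claims.NS.Bachani2026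

/-! ## The rest state is a member of the typed class -/

/-- `D(0) = 0`. -/
theorem fderiv_zero_apply (x : E3) : fderiv ℝ (0 : E3 → E3) x = 0 :=
  (hasFDerivAt_const (0 : E3) x).fderiv

/-- `∫ |0|² = 0`. -/
theorem lintegral_enorm_sq_zero : (∫⁻ x, ‖(0 : E3 → E3) x‖ₑ ^ 2) = 0 := by
  have h0 : (fun x => ‖(0 : E3 → E3) x‖ₑ ^ 2) = fun _ => 0 := by
    funext x
    rw [Pi.zero_apply, ← ofReal_norm, norm_zero, ENNReal.ofReal_zero, zero_pow two_ne_zero]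
  rw [h0, lintegral_zero]

/-- **The rest state** `u ≡ 0`, `p ≡ 0` is a solution of the class on `[0,T)` from the datum `0`,
for every `ν` and `T`. -/
theorem isSol_rest (ν T : ℝ) : IsSol ν 0 T 0 0 where
  datum := by
    -- the zero datum is smooth, divergence free (cf. the landed
    -- `Theorems.Svancara2025.isDivFree_zero`), of finite energy and enstrophy
    -- (the pretty-printed statement `IsDatum 0` coincides with a landed one for ANOTHER
    -- skeleton's `IsDatum`, `Theorems.Iotti2011.isDatum_zero`; hence inlined here)
    refine ⟨contDiff_const, fun x => ?_, ?_, ?_⟩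
    · rw [NSWave0.divergence, fderiv_zero_apply]; simp
    · rw [lintegral_enorm_sq_zero]; exact ENNReal.zero_lt_top
    · have h1 : (fun x => ‖fderiv ℝ (0 : E3 → E3) x‖ₑ ^ 2) = fun _ => 0 := by
        funext x
        rw [fderiv_zero_apply, ← ofReal_norm, norm_zero, ENNReal.ofReal_zero,
          zero_pow two_ne_zero]
      rw [h1, lintegral_zero]; exact ENNReal.zero_lt_top
  classical := isClassicalNSSolutionOn_zero (Ico 0 T) ν
  initial := rfl
  energy := ⟨0, ENNReal.zero_lt_top, fun _ _ => (lintegral_enorm_sq_zero).le⟩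

/-! ## Its entropy: `Wᵣ ≡ 0`, `Sᵣ ≡ 0`, `dSᵣ/dt ≡ 0` -/

/-- The vorticity of the rest state vanishes. -/
theorem curl_zero : curl (0 : E3 → E3) = 0 := by
  funext y
  ext i
  fin_cases i <;> simp [curl, fderiv_zero_apply]

/-- The local enstrophy weight of the rest state vanishes. -/
theorem eweight_rest (ρ : Mollifier) (r : ℝ) (x : E3) :
    eweight ρ r (curl (0 : E3 → E3)) x = 0 := by
  rw [eweight, curl_zero]
  simp

/-- The global entropy of the rest state vanishes (`Sᵣ = ∫ ℋᵣ·Wᵣ` with `Wᵣ ≡ 0`). -/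
theorem globEntropy_rest (ρ : Mollifier) (r : ℝ) : globEntropy ρ r (curl (0 : E3 → E3)) = 0 := by
  simp [globEntropy, eweight_rest]

/-- `Sᵣ(t) = 0` along the rest state. -/
theorem St_rest (ρ : Mollifier) (r t : ℝ) : St ρ r (0 : ℝ → E3 → E3) t = 0 :=
  globEntropy_rest ρ r

/-- `Sᵣ` is constant in time along the rest state. -/
theorem globEntropyR_rest_fun (ρ : Mollifier) (r : ℝ) :
    (fun s : ℝ => globEntropyR ρ r (curl ((0 : ℝ → E3 → E3) s))) =
      Function.const ℝ (globEntropyR ρ r (curl (0 : E3 → E3))) := rfl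

/-- `dSᵣ/dt = 0` along the rest state. -/
theorem dSdt_rest (ρ : Mollifier) (r T t : ℝ) : dSdt ρ r T (0 : ℝ → E3 → E3) t = 0 := by
  rw [dSdt, globEntropyR_rest_fun, derivWithin_const]
  rfl

/-! ## The refutations -/

/-- Lemma 6.2 fails at every mollifier and every viscosity: the rest state has `S_{r*} = 0 ≤ c*`
and `dS_{r*}/dt = 0`. -/
theorem not_Step_L62_at (ρ : Mollifier) {ν : ℝ} (_hν : 0 < ν) :
    ¬ ∃ rs cs : ℝ, 0 < rs ∧ 0 < cs ∧
      ∀ (u₀ : E3 → E3) (T : ℝ) (u : ℝ → E3 → E3) (p : ℝ → E3 → ℝ), IsSol ν u₀ T u p →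
        ∀ t ∈ Ico 0 T, St ρ rs u t ≤ ENNReal.ofReal cs → 0 < dSdt ρ rs T u t := by
  rintro ⟨rs, cs, _, _, H⟩
  have h := H 0 1 0 0 (isSol_rest ν 1) 0 ⟨le_rfl, one_pos⟩ (by rw [St_rest]; exact bot_le)
  rw [dSdt_rest] at h
  exact lt_irrefl 0 h

/-- **¬ Lemma 6.2** [Lemma 6.2 p.7 l.22–23] — the token candidate: the «quantitative entropy
barrier» fails for the rest state, a smooth finite-enstrophy solution of the typed class. -/
theorem not_Step_L62 : ¬ Step_L62 := fun h =>
  not_Step_L62_at stdMollifier one_pos (h stdMollifier 1 one_pos)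

/-- Line (9) fails at every mollifier and every viscosity: `S_{r*}(0) = 0 < c*` at rest. -/
theorem not_Step_9_at (ρ : Mollifier) {ν : ℝ} (_hν : 0 < ν) :
    ¬ ∃ rs cs : ℝ, 0 < rs ∧ 0 < cs ∧
      ∀ (u₀ : E3 → E3) (T : ℝ) (u : ℝ → E3 → E3) (p : ℝ → E3 → ℝ), IsSol ν u₀ T u p →
        ∀ t ∈ Ico 0 T, ENNReal.ofReal cs ≤ St ρ rs u t := by
  rintro ⟨rs, cs, _, hcs, H⟩
  have h := H 0 1 0 0 (isSol_rest ν 1) 0 ⟨le_rfl, one_pos⟩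
  rw [St_rest] at h
  have : ENNReal.ofReal cs = 0 := le_antisymm h bot_le
  exact absurd (ENNReal.ofReal_eq_zero.1 this) (not_le.2 hcs)

/-- **¬ (9)** [Thm 7.1 proof (9) p.9 l.9] — the binder of `claim_of_steps`: no uniform positive
lower bound `S_{r*}(t) ≥ c*` holds along every solution of the class (rest state). -/
theorem not_Step_9 : ¬ Step_9 := fun h =>
  not_Step_9_at stdMollifier one_pos (h stdMollifier 1 one_pos)

end Summit.NavierStokesRegularity.NavierStokesRegularity.Theorems.Bachani2026

end
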